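import Literature.Computability.Complexity.CircuitLightCone
import Summits.PneNP.PneNP.Theorems.OneSliceConstantBandDefs

/-!
# Route OneSlice, crux `ConstantBand` (stmt-PneNP-2834), line `flat-prior-relative-minterms`: light cones are at most linear in the size

Helper file (lead seat c7, 2026-08-17) for the unconditional low-exponent rungs of the crux schedule
(`Theorems/OneSliceConstantBandExponentOne.lean`): a circuit whose gates have fan-in `≤ K` reads at most `K·size`
input variables through its gates, so its output depends on at most `K·size + 1` inputs (`+1` for an output wire that
is itself an input). With `Circuit.eval_congr_lightCone` (Literature/…/CircuitLightCone.lean) this says that a circuit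
of size `s` over `{∧₂, ∨₂}` computes a `(2s+1)`-junta.

* `exists_deps_subset` — a set of at most `K · length` variables containing every dependency set (backward light cone
  of a gate) of a program with fan-in `≤ K` (induction along the straight-line program);
* `fprm_card_lightCone_le_size` — `#lightCone C ≤ K · C.size + 1`;
* `fprm_card_lightCone_le_of_monotoneBasis` / registered form `fprm_lightCone_junta` — over `{∧₂, ∨₂}`,
  `#lightCone C ≤ 2 · C.size + 1`.

Elementary; no definitions. [folklore]
-/

set_option linter.dupNamespace false

namespace Summit.PneNP.PneNP.Cruxes.ConstantBand.FlatPriorRelativeMinterms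

open Literature.Computability.Complexity Finset

variable {ι : Type*} [DecidableEq ι]

/-- A gate of fan-in `≤ K` reads at most `K` input variables directly. [folklore] -/
theorem card_biUnion_args_le (g : Gate ι) :
    #(univ.biUnion fun a : Fin g.arity => match g.args a with | .inl i => ({i} : Finset ι) | .inr _ => ∅) ≤
      g.arity :=
  calc #(univ.biUnion fun a : Fin g.arity => match g.args a with | .inl i => ({i} : Finset ι) | .inr _ => ∅)
      ≤ ∑ a : Fin g.arity, #(match g.args a with | .inl i => ({i} : Finset ι) | .inr _ => ∅) :=
        card_biUnion_le
    _ ≤ ∑ _a : Fin g.arity, 1 := sum_le_sum fun a _ => by cases g.args a <;> simp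
    _ = g.arity := by simp

/-- **Every backward light cone lies inside a set of at most `K · length` read variables**: for a program whose
gates have fan-in `≤ K` there is a set `S` of at most `K · length` input variables with `(deps gs)[m] ⊆ S` for every
gate index `m` (junk `∅` out of range). [folklore] -/
theorem exists_deps_subset {K : ℕ} (gs : List (Gate ι)) (hgs : ∀ g ∈ gs, g.arity ≤ K) :
    ∃ S : Finset ι, #S ≤ K * gs.length ∧ ∀ m, (GateList.deps gs).getD m ∅ ⊆ S := by
  induction gs using List.reverseRecOn with
  | nil => exact ⟨∅, by simp, fun m => by simp [GateList.deps]⟩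
  | append_singleton gs g ih =>
    obtain ⟨S, hS, hdep⟩ := ih fun g' hg' => hgs g' (by simp [hg'])
    have hg : g.arity ≤ K := hgs g (by simp)
    set G : Finset ι := univ.biUnion fun a : Fin g.arity =>
      match g.args a with | .inl i => ({i} : Finset ι) | .inr _ => ∅ with hG
    refine ⟨S ∪ G, ?_, fun m => ?_⟩
    · rw [List.length_append, List.length_singleton, Nat.mul_succ]
      calc #(S ∪ G) ≤ #S + #G := card_union_le _ _
        _ ≤ K * gs.length + g.arity := Nat.add_le_add hS (card_biUnion_args_le g)
        _ ≤ K * gs.length + K := by omega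
    · rw [GateList.deps_append_singleton]
      rcases lt_or_ge m gs.length with h | h
      · rw [List.getD_append _ _ _ _ (by simpa using h)]
        exact (hdep m).trans subset_union_left
      · rw [List.getD_append_right _ _ _ _ (by simpa using h)]
        rcases Nat.lt_or_ge (m - gs.length) 1 with h1 | h1
        · have h0 : m - (GateList.deps gs).length = 0 := by simp; omega
          rw [h0, List.getD_cons_zero]
          intro i hi
          simp only [GateList.depOf, mem_biUnion, mem_univ, true_and] at hi
          obtain ⟨a, ha⟩ := hi
          cases hga : g.args a with
          | inl i' =>
            rw [hga] at ha
            simp only [mem_singleton] at ha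
            subst ha
            refine mem_union_right _ (mem_biUnion.2 ⟨a, mem_univ _, ?_⟩)
            rw [hga]
            exact mem_singleton_self i
          | inr m' =>
            rw [hga] at ha
            exact mem_union_left _ (hdep m' ha)
        · rw [List.getD_eq_default _ _ (by simp; omega)]
          exact empty_subset _

/-- **Light cones are at most linear in the size**: if every gate of `C` has fan-in `≤ K`, the output of `C`
depends on at most `K · C.size + 1` input variables. [folklore] -/
theorem fprm_card_lightCone_le_size (C : Circuit ι) {K : ℕ} (hC : ∀ g ∈ C.gates, g.arity ≤ K) :
    #C.lightCone ≤ K * C.size + 1 := by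
  obtain ⟨S, hS, hdep⟩ := exists_deps_subset C.gates hC
  unfold Circuit.lightCone Circuit.size
  cases C.output with
  | inl i => simp
  | inr m =>
    calc #((GateList.deps C.gates).getD m ∅) ≤ #S := card_le_card (hdep m)
      _ ≤ K * C.gates.length := hS
      _ ≤ K * C.gates.length + 1 := Nat.le_succ _

omit [DecidableEq ι] in
/-- Over `{∧₂, ∨₂}` every gate has fan-in `2`. [folklore] -/
theorem arity_le_two_of_isOver_monotoneBasis {C : Circuit ι} (hC : C.IsOver monotoneBasis) :
    ∀ g ∈ C.gates, g.arity ≤ 2 := fun g hg =>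
  (hC.mono (monotoneBasis_subset_deMorgan.trans deMorganBasis_subset_B2)) g hg

/-- **A `{∧₂, ∨₂}`-circuit of size `s` is a `(2s+1)`-junta**: its light cone has at most `2·size + 1` variables
(and `Circuit.eval_congr_lightCone` says the output only depends on them). [folklore] -/
theorem fprm_card_lightCone_le_of_monotoneBasis (C : Circuit ι) (hC : C.IsOver monotoneBasis) :
    #C.lightCone ≤ 2 * C.size + 1 :=
  fprm_card_lightCone_le_size C (arity_le_two_of_isOver_monotoneBasis hC)

/-- **Registered form** (sub-goal `fprm_lightCone_junta` of stmt-PneNP-2834): over the edge variables of `K_n`, a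
`{∧₂, ∨₂}`-circuit of size `s` has a light cone of at most `2s + 1` edges. [folklore] -/
theorem fprm_lightCone_junta :
    ∀ (n : ℕ) (C : Circuit (Edge n)), C.IsOver monotoneBasis → #C.lightCone ≤ 2 * C.size + 1 :=
  fun _ C hC => fprm_card_lightCone_le_of_monotoneBasis C hC

end Summit.PneNP.PneNP.Cruxes.ConstantBand.FlatPriorRelativeMinterms
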